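import Mathlib
import Summits.QuantumFields.BalabanUV.T4Continuum.Support.SliceCovariantPrincipal

/-!
# T⁴ programme, node NE3 (η-rate of the minimisers) — the one type with LEVEL-BOUNDED stability readings: [B9]'s printed
# statements are asked only for the levels `j ≤ k` whose blocks fit in the torus

Thirteenth generation of the NE3 prover lineage P1 of the cell `pub-balaban`, file 8.  The one type
`SliceCovariantPrincipal.ne3Shape_torusCovE_of_printedStatements` (p198587) indexes its three printed-statement hypotheses
(`hT31`, `hT349`, `hT311`) by ALL triples `(k, V, j)`, although the `k + 1` resolvent slices of level `k` — `sliceKernel … (j+1) =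
G_j (K_j − K_{j+1}) (G_{j+1} D)` — only involve the auxiliary propagators of levels `j ≤ k`.  For `j > k` the level-`j` blocks of
the model saturate (`side k L j = L^{min(j,k)}`: a block cannot exceed the torus) while the skeleton's mass coefficient
`am∕(L^j)^{d+2}` keeps shrinking, so the hypotheses at those levels are an ARTEFACT: meaningless for Bałaban's objects and, for
(3.49)-type bounds on the remainder form of the flat family (`SliceFlatOperators.flatNg`), even false.  THIS FILE removes the
artefact without touching any engine:
 * §1 truncation bookkeeping — slices up to `n` depend only on the data up to `n` (`sliceKernel_congr_upto`); the ZERO carrier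
   families satisfy the typed (3.42)∕(3.49) (`ineq342_matrixFamily_zero`, `ineq349_fineKernelOf_zero`); `kPart`∕`kLevE`∕`gLevE`
   depend on `Ng` only through `Ng j` (`kPart_congr` …);
 * §2 **`ne3Shape_torusCovE_upto_of_printedStatements`** — THE ONE TYPE WITH LEVEL-BOUNDED READINGS: identical to p198587 except
   that `hT31`∕`hT349`∕`hT311` are indexed by `LevIdx ι = {(k, V, j) // j ≤ k}`.  Proof: per `(k, V)`, TRUNCATE the family beyond
   level `k` (propagators and carriers `0`, gauge forms `0` — the typed shapes hold trivially there; for the telescoping,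
   gauge forms `1 − E − massKernel_j` so that the level operator is the identity, positive definite) and apply the total
   theorems `SliceCovariantPrincipal.sliceKernel_bound_torusCovE_of_printedType` ∕ `sum_sliceKernel_covE` to the truncated
   family, whose slices `≤ k` and whose `G_k` are the original ones.
STRICTLY WEAKER HYPOTHESES, SAME CONCLUSION; the flat rung's discharges (`SliceFlatOperators.gLevE_flat_rowBound`,
`posDef_kLevE_flat`) are unaffected (they hold at every level anyway), and (3.49) for `flatNg` now only has to hold for `j ≤ k`.

Honest framing: finite-T⁴ ultraviolet bookkeeping about MINIMISERS (rung (B)+1 of the cell's ladder); no conditional of the cell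
(`BetaPertH`, (B), (B^μ)) is used or hidden; nothing bears on infinite volume, a mass gap, or the Clay problem; **NE3 is NOT
proved**.  ABSOLUTE RULE of the cell kept: B9's theorems enter only as HYPOTHESES of the tree's typed, cite-tagged shapes; nothing
printed is asserted.  No `sorry`, no axioms beyond Mathlib's.  PLACEMENT (human rule 2026-08-19): cell work under
`Summits/QuantumFields/BalabanUV/`; imports `Support.SliceCovariantPrincipal` (p198587); moves nothing.  Records:
`t4/T4-EST-U1b-OSC.md` v1.27, `t4/T4-EST-NE3-P1.md` v2.26, GAPS G-ne3p1-41 of the cell `pub-balaban`.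
-/

noncomputable section

open Finset Real Matrix

namespace Summit.QuantumFields.BalabanUV.T4Continuum.SliceCovariantLevels

open Literature.MathematicalPhysics.QuantumFieldTheory.Balaban1983to89
open Literature.MathematicalPhysics.QuantumFieldTheory.Balaban1983to89.TreeLengthTorus (TPt)
open Literature.MathematicalPhysics.QuantumFieldTheory.Balaban1983to89.B9Thm37GlueTorusCov (Comb)
open Literature.MathematicalPhysics.QuantumFieldTheory.Balaban1983to89.T4SliceTelescoping (sliceKernel sliceConst)
open Literature.MathematicalPhysics.QuantumFieldTheory.Balaban1983to89.T4EtaRateMin (Readings NE3Shape)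
open Literature.MathematicalPhysics.QuantumFieldTheory.Balaban1983to89.T4FixedPointResponse (OneStepCorrectionRate)
open Literature.MathematicalPhysics.QuantumFieldTheory.Balaban1983to89.T4SliceOperatorData
open Summit.QuantumFields.BalabanUV.T4Continuum.SliceTorusBlocks
open Summit.QuantumFields.BalabanUV.T4Continuum.SliceTorusBlockModel
open Summit.QuantumFields.BalabanUV.T4Continuum.SliceTorusTower
open Summit.QuantumFields.BalabanUV.T4Continuum.SliceTorusFaces
open Summit.QuantumFields.BalabanUV.T4Continuum.SliceCovariantModel
open Summit.QuantumFields.BalabanUV.T4Continuum.SliceCovariantTower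
open Summit.QuantumFields.BalabanUV.T4Continuum.SliceCovariantSkeleton
open Summit.QuantumFields.BalabanUV.T4Continuum.SliceCovariantPrincipal

/-! ## §1  Truncation bookkeeping -/
section Truncation

/-- **Slices up to `n` depend only on the data up to level `n`.** [folklore] -/
theorem sliceKernel_congr_upto {X : Type*} [Fintype X] (G G' K K' : ℕ → Matrix X X ℝ) (D : Matrix X X ℝ) (n : ℕ)
    (hG : ∀ j, j ≤ n → G j = G' j) (hK : ∀ j, j ≤ n → K j = K' j) :
    ∀ i, i ≤ n → sliceKernel G K D i = sliceKernel G' K' D i := by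
  intro i hi
  funext x y
  cases i with
  | zero => simp only [sliceKernel, hG 0 hi]
  | succ j =>
      have hj : j ≤ n := by omega
      simp only [sliceKernel, hG j hj, hG (j + 1) hi, hK j hj, hK (j + 1) hi]

variable {X S : Type} [Fintype X] [DecidableEq S] {Bg : B9.Backgrounds}

/-- The ZERO matrix carrier satisfies the typed (3.42) (all row masses vanish). [folklore] -/
theorem ineq342_matrixFamily_zero (blk : X → S) (dist : S → S → ℝ) (j : ℕ) {L : ℝ} (M : ℝ) {B₀ δ₀ : ℝ}
    (U : Bg.Cfg) (hB₀ : 0 ≤ B₀) (hL : 0 ≤ L) :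
    B9.Ineq342_346_347 (matrixFamily blk dist j L M (fun (_ : Fin 4) (_ : Bg.Cfg) => (0 : Matrix X X ℝ))) B₀ δ₀ U := by
  refine ineq342_matrixFamily_of_rowBounds blk dist j M _ U hB₀ hL fun m x y₁ => ?_
  simp only [Matrix.zero_apply, abs_zero, Finset.sum_const_zero]
  exact mul_nonneg (mul_nonneg hB₀ (B9FromB6.pref4_nonneg (pow_nonneg hL j) m)) (Real.exp_nonneg _)

/-- The ZERO fine-kernel carrier satisfies the typed (3.49). [folklore] -/
theorem ineq349_fineKernelOf_zero (blk : X → S) (dist : S → S → ℝ) (j : ℕ) {L : ℝ} (M : ℝ) {d : ℕ} {C δ₀ : ℝ}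
    (U : Bg.Cfg) (hC : 0 ≤ C) (hL : 0 < L) :
    B9.Ineq349 d (fineKernelOf blk dist j L M (fun (_ : Fin 4) (_ : Bg.Cfg) => (0 : Matrix X X ℝ))) C δ₀ U := by
  refine ineq349_fineKernelOf_of_entryBounds blk dist j M _ U hC hL fun n z w => ?_
  rw [Matrix.zero_apply, abs_zero]
  have hpi : 0 ≤ B9.pref4inv (L ^ j) n := by
    fin_cases n <;> simp [B9.pref4inv] <;> positivity
  exact mul_nonneg (mul_nonneg (mul_nonneg hC hpi) (Real.rpow_nonneg (pow_pos hL j).le _)) (Real.exp_nonneg _)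

variable {St Bd Cp : Type} [Fintype Cp] [DecidableEq Cp] {src tgt : Bd → St} {Bk : ℕ → Type} [∀ j, DecidableEq (Bk j)]
  {Kc : ∀ j, Comb src tgt (Bk j)} {Rm : Bd → Cp → Cp → ℝ} {w a : ℕ → ℝ} {Ng Ng' : ℕ → Matrix (St × Cp) (St × Cp) ℝ}

/-- `kPart` sees `Ng` only through `Ng j`. [folklore] -/
theorem kPart_congr {j : ℕ} (h : Ng j = Ng' j) : kPart Kc Rm w a Ng j = kPart Kc Rm w a Ng' j := by
  unfold kPart; rw [h]

variable {E : Matrix (St × Cp) (St × Cp) ℝ}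

/-- `kLevE` sees `Ng` only through `Ng j`. [folklore] -/
theorem kLevE_congr {j : ℕ} (h : Ng j = Ng' j) : kLevE E Kc Rm w a Ng j = kLevE E Kc Rm w a Ng' j := by
  unfold kLevE; rw [kPart_congr h]

variable [Fintype St] [DecidableEq St]

/-- `gLevE` sees `Ng` only through `Ng j`. [folklore] -/
theorem gLevE_congr {j : ℕ} (h : Ng j = Ng' j) : gLevE E Kc Rm w a Ng j = gLevE E Kc Rm w a Ng' j := by
  unfold gLevE; rw [kLevE_congr h]

end Truncation

/-! ## §2  THE ONE TYPE WITH LEVEL-BOUNDED STABILITY READINGS -/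
section Skeleton

/-- The LEVEL-BOUNDED family index: triples `(k, V, j)` with `j ≤ k` (the level-`j` blocks, of side `L^j`, fit in the level-`k`
torus of side `N·L^k`). [model] [folklore] -/
def LevIdx (ι : Type) : Type := {p : ℕ × ι × ℕ // p.2.2 ≤ p.1}

variable (d N L : ℕ) [NeZero N] [NeZero L] (Cp : Type) [Fintype Cp] [DecidableEq Cp] (Bd : ℕ → Type)

/-- **NE3's typed skeleton, covariant E-edition with LEVEL-BOUNDED stability readings.**  Identical to
`SliceCovariantPrincipal.ne3Shape_torusCovE_of_printedStatements` (p198587) — data per `(k, V)`: bond structure, isometric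
transports `Rm k V` (`hRm`), combs with `blk = cube` (`hblk`), masses `0 ≤ am ≤ amax`, level-free principal part `E k V`,
sign-free gauge forms `Ng k V j`, derivative matrix `D k V`; operators `G k V j := gLevE (E k V) … j`; consistency readings
`hdl … hpair` — EXCEPT that the three printed-statement hypotheses `hT31` ([B9] Thm 3.1), `hT349` ((3.49)), `hT311` (Thm 3.11)
are indexed by `LevIdx ι = {(k, V, j) // j ≤ k}`: the print is asked only for levels whose blocks fit in the torus.  CONCLUSION
unchanged: printed thresholds `M₁, a₀ > 0` exist such that, once `M₁ ≤ M`, `Mα₀ ≤ a₀` and every background `U k V j` with `j ≤ k`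
(`V ∈ dom`) is in the class (3.35), `NE3Shape R C′ (L^{−a})` for some `C′`.  Proof by TRUNCATION of the family beyond level `k`
and the total theorems of `SliceCovariantPrincipal`.  HONEST: a SKELETON — NE3 is NOT proved. [folklore] -/
theorem ne3Shape_torusCovE_upto_of_printedStatements {ι : Type} {Xr : Type*} [Fintype Xr] {R : Readings ι Xr} (M c35 : ℝ)
    (Bg : ℕ → ι → ℕ → B9.Backgrounds) (U : ∀ k V j, (Bg k V j).Cfg)
    (dist : ∀ k j : ℕ, TPt d (levM k N L j) → TPt d (levM k N L j) → ℝ)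
    (A Fk : ∀ (k : ℕ) (V : ι) (j : ℕ), Fin 4 → (Bg k V j).Cfg →
      Matrix (TPt d (N * L ^ k) × Cp) (TPt d (N * L ^ k) × Cp) ℝ)
    (E : ∀ k : ℕ, ι → Matrix (TPt d (N * L ^ k) × Cp) (TPt d (N * L ^ k) × Cp) ℝ)
    (src tgt : ∀ k : ℕ, Bd k → TPt d (N * L ^ k))
    (Kc : ∀ (k : ℕ) (_ : ι) (j : ℕ), Comb (src k) (tgt k) (TPt d (levM k N L j)))
    (Rm : ∀ k : ℕ, ι → Bd k → Cp → Cp → ℝ) (am : ℕ → ι → ℕ → ℝ)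
    (Ng : ∀ k : ℕ, ι → ℕ → Matrix (TPt d (N * L ^ k) × Cp) (TPt d (N * L ^ k) × Cp) ℝ)
    (D : ∀ k : ℕ, ι → Matrix (TPt d (N * L ^ k) × Cp) (TPt d (N * L ^ k) × Cp) ℝ)
    {z dl sig blk lam t osc nrm pair : ℕ → ι → ℝ} {CJ CB B CPo CD B0 CR Γ Λr ρ₂ a amax : ℝ}
    (hL : 2 ≤ L) (ha0 : 0 < a) (ha : a < 1) (hd : 2 ≤ d) (hamax : 0 ≤ amax)
    -- the structural data of the covariant family
    (hRm : ∀ k V b i j, ∑ m, Rm k V b m i * Rm k V b m j = if i = j then (1 : ℝ) else 0)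
    (hblk : ∀ k V j x, (Kc k V j).blk x = cube d k N L j x)
    (ham : ∀ k V j, 0 ≤ am k V j ∧ am k V j ≤ amax)
    -- STABILITY: the printed family statements for THIS family, LEVELS `j ≤ k` ONLY
    (hbd : ∀ k j y y₁, (nbd d k N L j y y₁ : ℝ) ≤ dist k j y y₁)
    (hT31 : B9.Thm31Printed c35
      (fun p : LevIdx ι => blockGeom (cubeI d p.1.1 N L Cp p.1.2.2) (dist p.1.1 p.1.2.2) p.1.2.2 (L : ℝ) M)
      (fun p : LevIdx ι => Bg p.1.1 p.1.2.1 p.1.2.2)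
      (fun p : LevIdx ι =>
        matrixFamily (cubeI d p.1.1 N L Cp p.1.2.2) (dist p.1.1 p.1.2.2) p.1.2.2 (L : ℝ) M (A p.1.1 p.1.2.1 p.1.2.2)))
    (hT349 : B9.Stmt349Printed d c35
      (fun p : LevIdx ι => blockGeom (cubeI d p.1.1 N L Cp p.1.2.2) (dist p.1.1 p.1.2.2) p.1.2.2 (L : ℝ) M)
      (fun p : LevIdx ι => Bg p.1.1 p.1.2.1 p.1.2.2)
      (fun p : LevIdx ι =>
        fineKernelOf (cubeI d p.1.1 N L Cp p.1.2.2) (dist p.1.1 p.1.2.2) p.1.2.2 (L : ℝ) M (Fk p.1.1 p.1.2.1 p.1.2.2)))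
    (hT311 : B9.Thm311Printed c35
      (fun p : LevIdx ι => blockGeom (cubeI d p.1.1 N L Cp p.1.2.2) (dist p.1.1 p.1.2.2) p.1.2.2 (L : ℝ) M)
      (fun p : LevIdx ι => Bg p.1.1 p.1.2.1 p.1.2.2)
      (fun p _ _ => (kLevE (E p.1.1 p.1.2.1) (Kc p.1.1 p.1.2.1) (Rm p.1.1 p.1.2.1) (wB L d)
        (aB L d (am p.1.1 p.1.2.1)) (Ng p.1.1 p.1.2.1) p.1.2.2).PosDef))
    (hA0 : ∀ k V j, A k V j 0 (U k V j)
      = gLevE (E k V) (Kc k V) (Rm k V) (wB L d) (aB L d (am k V)) (Ng k V) j)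
    (hA1 : ∀ k V j, A k V j 1 (U k V j)
      = (gLevE (E k V) (Kc k V) (Rm k V) (wB L d) (aB L d (am k V)) (Ng k V) j * D k V).transpose)
    (hF3 : ∀ k V j, Fk k V j 3 (U k V j) = Ng k V j)
    -- CONSISTENCY: the located readings (unprinted), `hdl` on a row of `G_k·D` over the face skeleton
    (hdl : ∀ k, ∀ V ∈ R.dom, ∃ x : TPt d (N * L ^ k) × Cp,
      dl k V ≤ ∑ y ∈ faceSkelI d k N L Cp,
        |(gLevE (E k V) (Kc k V) (Rm k V) (wB L d) (aB L d (am k V)) (Ng k V) k * D k V) x y|)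
    (h1 : ∀ k : ℕ, ∀ V ∈ R.dom, z k V ≤ dl k V * sig k V + blk k V)
    (h3 : ∀ k : ℕ, ∀ V ∈ R.dom, 0 ≤ sig k V ∧ sig k V ≤ CJ * lam k V)
    (h4 : ∀ k : ℕ, ∀ V ∈ R.dom, 0 ≤ blk k V ∧ blk k V ≤ CB * (1 + k * Real.log L) * lam k V)
    (h5 : ∀ k : ℕ, ∀ V ∈ R.dom, 0 ≤ lam k V ∧ lam k V ≤ B * ((L : ℝ)⁻¹ ^ k) ^ 3)
    (hCJ : 0 ≤ CJ) (hCB : 0 ≤ CB) (hCPo : 0 ≤ CPo) (hCD : 0 ≤ CD) (hB : 0 ≤ B) (hB0 : 0 ≤ B0) (hCR : 0 ≤ CR)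
    (hΓ : 0 ≤ Γ) (hΛr : 0 ≤ Λr) (hρ₂ : 0 ≤ ρ₂)
    (ht : ∀ k : ℕ, ∀ V ∈ R.dom, t k V ≤ B0 * CR * (L : ℝ)⁻¹ ^ k)
    (hosc : ∀ k : ℕ, ∀ V ∈ R.dom, osc k V ≤ (1 + CD) * (1 + CPo) * z k V / ((L : ℝ)⁻¹ ^ k) ^ 2 + t k V)
    (hact : ∀ k : ℕ, ∀ V ∈ R.dom, R.act k V = ∑ x, R.loc k V x) (hvol : (Fintype.card Xr : ℝ) ≤ R.vol)
    (hread : ∀ k : ℕ, ∀ V ∈ R.dom, ∀ x : Xr,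
      |R.loc (k + 1) V x - R.loc k V x| ≤ Λr * nrm k V + pair k V)
    (hresp : ∀ k : ℕ, ∀ V ∈ R.dom, nrm k V ≤ Γ * osc k V)
    (hpair : OneStepCorrectionRate R.dom pair ρ₂ ((L : ℝ) ^ (-a))) :
    ∃ M₁ a₀ : ℝ, 0 < M₁ ∧ 0 < a₀ ∧
      (M₁ ≤ M → ∀ α₀ : ℝ, 0 < α₀ → M * α₀ ≤ a₀ →
        (∀ k V j, V ∈ R.dom → j ≤ k → (Bg k V j).Reg335 c35 α₀ (U k V j)) →
          ∃ C' : ℝ, NE3Shape R C' ((L : ℝ) ^ (-a))) := by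
  obtain ⟨M₁, δ₀, a₀, B₀, Bβ, Bε, Bεβ, hM₁, hδ₀, ha₀', hB₀, h31⟩ := hT31
  obtain ⟨M₁', δ₁, a₀'', C₃, hM₁', hδ₁, ha₀'', hC₃, h49⟩ := hT349
  obtain ⟨M₃, a₃, hM₃, ha₃, h311⟩ := hT311
  refine ⟨max (max M₁ M₁') M₃, min (min a₀ a₀'') a₃, lt_max_of_lt_left (lt_max_of_lt_left hM₁),
    lt_min (lt_min ha₀' ha₀'') ha₃, fun hM α₀ hα₀ hMa hreg => ?_⟩
  have hM12 : max M₁ M₁' ≤ M := le_trans (le_max_left _ _) hM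
  have hMa12 : M * α₀ ≤ min a₀ a₀'' := le_trans hMa (min_le_left _ _)
  have hLpos : 0 < L := by omega
  have hLr : (1 : ℝ) ≤ L := by exact_mod_cast one_le_L L
  have hLr0 : (0 : ℝ) < L := by linarith
  -- the decay rate of the slices: `δ = min(δ₀, δ₁/2)/2`
  set δ : ℝ := min δ₀ (δ₁ / 2) / 2 with hδdef
  have hmin : 0 < min δ₀ (δ₁ / 2) := lt_min hδ₀ (by linarith)
  have hδpos : 0 < δ := by rw [hδdef]; linarith
  have hδ₀' : δ < δ₀ := by
    have h1 : min δ₀ (δ₁ / 2) ≤ δ₀ := min_le_left _ _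
    rw [hδdef]; linarith
  have hδ₁' : δ ≤ δ₁ / 2 := by
    have h1 : min δ₀ (δ₁ / 2) ≤ δ₁ / 2 := min_le_right _ _
    rw [hδdef]; linarith
  -- the level-free slice constant
  set C : ℝ := printedCA B₀ δ₀ δ d ((2 : ℝ) ^ d) d
      * (1 + printedCA B₀ δ₀ δ d ((2 : ℝ) ^ d) d * printedCP amax C₃ δ₁ δ L d d) with hCdef
  have hC : 0 ≤ C := by
    have h1 : 0 ≤ printedCA B₀ δ₀ δ d ((2 : ℝ) ^ d) d := printedCA_nonneg hB₀.le (by positivity) hδ₀'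
    have h2 : 0 ≤ printedCP amax C₃ δ₁ δ (L : ℝ) d d := printedCP_nonneg hamax hC₃.le hLr
    rw [hCdef]; positivity
  -- the printed statements, instantiated at the levels `j ≤ k`
  have h342 : ∀ k, ∀ V ∈ R.dom, ∀ j, j ≤ k → B9.Ineq342_346_347
      (matrixFamily (cubeI d k N L Cp j) (dist k j) j (L : ℝ) M (A k V j)) B₀ δ₀ (U k V j) :=
    fun k V hV j hj => (h31 ⟨(k, V, j), hj⟩ (le_trans (le_max_left _ _) hM12) α₀ hα₀
      (le_trans hMa12 (min_le_left _ _)) (U k V j) (hreg k V j hV hj)).1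
  have h349 : ∀ k, ∀ V ∈ R.dom, ∀ j, j ≤ k → B9.Ineq349 d
      (fineKernelOf (cubeI d k N L Cp j) (dist k j) j (L : ℝ) M (Fk k V j)) C₃ δ₁ (U k V j) :=
    fun k V hV j hj => h49 ⟨(k, V, j), hj⟩ (le_trans (le_max_right _ _) hM12) α₀ hα₀
      (le_trans hMa12 (min_le_right _ _)) (U k V j) (hreg k V j hV hj)
  have hposk : ∀ k, ∀ V ∈ R.dom, ∀ j, j ≤ k →
      (kLevE (E k V) (Kc k V) (Rm k V) (wB L d) (aB L d (am k V)) (Ng k V) j).PosDef :=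
    fun k V hV j hj => h311 ⟨(k, V, j), hj⟩ (le_trans (le_max_right _ _) hM) α₀ hα₀
      (le_trans hMa (min_le_right _ _)) (U k V j) (hreg k V j hV hj) 0
  -- the slice bounds `hg` via the family TRUNCATED beyond level `k` (propagators, carriers and gauge forms set to 0)
  have hg : ∀ k, ∀ V ∈ R.dom, ∀ i < k + 1, ∀ x y : TPt d (N * L ^ k) × Cp,
      |sliceKernel (gLevE (E k V) (Kc k V) (Rm k V) (wB L d) (aB L d (am k V)) (Ng k V))
          (kPart (Kc k V) (Rm k V) (wB L d) (aB L d (am k V)) (Ng k V)) (D k V) i x y|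
        ≤ C * (Real.exp (-(δ * ((nplI d k N L Cp x y : ℝ) / (L : ℝ) ^ i))) / ((L : ℝ) ^ i) ^ (d - 1)) := by
    intro k V hV i hi x y
    -- truncated data
    let Ng0 : ℕ → Matrix (TPt d (N * L ^ k) × Cp) (TPt d (N * L ^ k) × Cp) ℝ :=
      fun j => if j ≤ k then Ng k V j else 0
    let G0 : ℕ → Matrix (TPt d (N * L ^ k) × Cp) (TPt d (N * L ^ k) × Cp) ℝ :=
      fun j => if j ≤ k then gLevE (E k V) (Kc k V) (Rm k V) (wB L d) (aB L d (am k V)) (Ng k V) j else 0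
    let A0 : ∀ j, Fin 4 → (Bg k V j).Cfg → Matrix (TPt d (N * L ^ k) × Cp) (TPt d (N * L ^ k) × Cp) ℝ :=
      fun j m u => if j ≤ k then A k V j m u else 0
    let F0 : ∀ j, Fin 4 → (Bg k V j).Cfg → Matrix (TPt d (N * L ^ k) × Cp) (TPt d (N * L ^ k) × Cp) ℝ :=
      fun j m u => if j ≤ k then Fk k V j m u else 0
    have hK0 := kPart_eq_massKernel (Kc k V) (Rm k V) (am k V) Ng0 (hblk k V)
    have hbound := sliceKernel_bound_torusI_of_printedType d k N L Cp M (dist k) (Bg k V) (U k V) A0 F0 G0 Ng0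
      (kPart (Kc k V) (Rm k V) (wB L d) (aB L d (am k V)) Ng0) (D k V) (fun j => tau (Kc k V j) (Rm k V)) (am k V)
      (by omega) hB₀.le hC₃.le hδpos.le hδ₀' hδ₁' hamax (hbd k) (fun j => ?_) (fun j => ?_) (fun j => ?_)
      (fun j => ?_) (fun j => ?_) (fun j z w => abs_tau_le_one (Kc k V j) (Rm k V) (hRm k V) z w) (ham k V) hK0
    · -- the slices `i ≤ k` of the truncated family are the original ones
      have hcongr := sliceKernel_congr_upto G0
        (gLevE (E k V) (Kc k V) (Rm k V) (wB L d) (aB L d (am k V)) (Ng k V))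
        (kPart (Kc k V) (Rm k V) (wB L d) (aB L d (am k V)) Ng0)
        (kPart (Kc k V) (Rm k V) (wB L d) (aB L d (am k V)) (Ng k V)) (D k V) k
        (fun j hj => by simp [G0, hj]) (fun j hj => kPart_congr (by simp [Ng0, hj])) i (by omega)
      rw [← hcongr, cast_nplI]
      exact hbound i x y
    · show A0 j 0 (U k V j) = G0 j
      by_cases hj : j ≤ k
      · simp only [A0, G0, if_pos hj]; exact hA0 k V j
      · simp only [A0, G0, if_neg hj]
    · show A0 j 1 (U k V j) = (G0 j * D k V).transpose
      by_cases hj : j ≤ k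
      · simp only [A0, G0, if_pos hj]; exact hA1 k V j
      · simp only [A0, G0, if_neg hj, Matrix.zero_mul, Matrix.transpose_zero]
    · show F0 j 3 (U k V j) = Ng0 j
      by_cases hj : j ≤ k
      · simp only [F0, Ng0, if_pos hj]; exact hF3 k V j
      · simp only [F0, Ng0, if_neg hj]
    · by_cases hj : j ≤ k
      · have hA : A0 j = A k V j := by funext m u; simp [A0, hj]
        rw [hA]; exact h342 k V hV j hj
      · have hA : A0 j = fun _ _ => 0 := by funext m u; simp [A0, hj]
        rw [hA]; exact ineq342_matrixFamily_zero _ _ j M (U k V j) hB₀.le hLr0.le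
    · by_cases hj : j ≤ k
      · have hF : F0 j = Fk k V j := by funext m u; simp [F0, hj]
        rw [hF]; exact h349 k V hV j hj
      · have hF : F0 j = fun _ _ => 0 := by funext m u; simp [F0, hj]
        rw [hF]; exact ineq349_fineKernelOf_zero _ _ j M (U k V j) hC₃.le hLr0
  -- the located reading `hdl`, TELESCOPED via the family truncated beyond level `k` (level operator := identity there)
  have hdl' : ∀ k, ∀ V ∈ R.dom, ∃ x : TPt d (N * L ^ k) × Cp,
      dl k V ≤ ∑ y ∈ faceSkelI d k N L Cp, |∑ i ∈ Finset.range (k + 1),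
        sliceKernel (gLevE (E k V) (Kc k V) (Rm k V) (wB L d) (aB L d (am k V)) (Ng k V))
          (kPart (Kc k V) (Rm k V) (wB L d) (aB L d (am k V)) (Ng k V)) (D k V) i x y| := by
    intro k V hV
    obtain ⟨x, hx⟩ := hdl k V hV
    refine ⟨x, hx.trans (le_of_eq (Finset.sum_congr rfl fun y _ => ?_))⟩
    let NgT : ℕ → Matrix (TPt d (N * L ^ k) × Cp) (TPt d (N * L ^ k) × Cp) ℝ := fun j =>
      if j ≤ k then Ng k V j else
        1 - E k V - massKernel (fun p : TPt d (N * L ^ k) × Cp => (Kc k V j).blk p.1) (tau (Kc k V j) (Rm k V))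
          (aB L d (am k V) j * wB L d j ^ 2)
    have hposT : ∀ j, (kLevE (E k V) (Kc k V) (Rm k V) (wB L d) (aB L d (am k V)) NgT j).PosDef := by
      intro j
      by_cases hj : j ≤ k
      · rw [kLevE_congr (Ng' := Ng k V) (by simp [NgT, hj])]; exact hposk k V hV j hj
      · have h1 : kLevE (E k V) (Kc k V) (Rm k V) (wB L d) (aB L d (am k V)) NgT j = 1 := by
          unfold kLevE kPart
          simp only [NgT, if_neg hj]
          abel
        rw [h1]; exact Matrix.PosDef.one
    have htel := sum_sliceKernel_covE hposT (D k V) k x y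
    have hcongr := sliceKernel_congr_upto
      (gLevE (E k V) (Kc k V) (Rm k V) (wB L d) (aB L d (am k V)) NgT)
      (gLevE (E k V) (Kc k V) (Rm k V) (wB L d) (aB L d (am k V)) (Ng k V))
      (kPart (Kc k V) (Rm k V) (wB L d) (aB L d (am k V)) NgT)
      (kPart (Kc k V) (Rm k V) (wB L d) (aB L d (am k V)) (Ng k V)) (D k V) k
      (fun j hj => gLevE_congr (by simp [NgT, hj])) (fun j hj => kPart_congr (by simp [NgT, hj]))
    rw [gLevE_congr (Ng' := Ng k V) (by simp [NgT]), Finset.sum_congr rfl fun i hi =>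
      congrFun (congrFun (hcongr i (by have := Finset.mem_range.1 hi; omega)) x) y] at htel
    rw [htel]
  exact ⟨_, ne3Shape_of_slices_rpow_card0 (fun k => faceSkelI d k N L Cp) (fun k => nplI d k N L Cp)
    (fun k V i => sliceKernel (gLevE (E k V) (Kc k V) (Rm k V) (wB L d) (aB L d (am k V)) (Ng k V))
      (kPart (Kc k V) (Rm k V) (wB L d) (aB L d (am k V)) (Ng k V)) (D k V) i)
    (fun k => d * (N * L ^ k)) (by exact_mod_cast hL) ha0 ha hδpos hC
    (mul_nonneg (Nat.cast_nonneg _) faceConst_nonneg : (0 : ℝ) ≤ Fintype.card Cp * faceConst d N)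
    (Nat.cast_nonneg _) (faces_hℓ d N hd) hd
    (fun k x => card_faceSkelI_zero_le x) (fun k x y _ => nplI_le x y) (faces_hN d N L)
    (fun k x r hr => card_faceSkelI_shell_le hd x r hr) hg hdl' h1 h3 h4 h5 hCJ hCB hCPo hCD hB hB0 hCR hΓ
    hΛr hρ₂ ht hosc hact hvol hread hresp hpair⟩

end Skeleton

end Summit.QuantumFields.BalabanUV.T4Continuum.SliceCovariantLevels
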